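import Mathlib
import Summits.NavierStokesRegularity.NavierStokesRegularity.Theses.QuasipotentialCoercivity
import HarnessLib

/-!
# `QuasipotentialCoercivity.Assembly` — the route's assembly
  (item stmt-NavierStokesRegularity-1448; pure logic)

**Statement.** `ActionCoercivityL3 → ReachableAlongFlow → L3Closure → NoBlowupToClay →
NavierStokesRegularity` (signatures expanded in the route file).

PROOF (the planner's eight lines). Fix `ν, T, u, p` as in `NoBlowup`; `ReachableAlongFlow` gives
`(τ, a)` with every slice `u t`, `t < T`, reachable; `ActionCoercivityL3` gives `C(ν, τ, a)`, so
`⨆_{t ∈ [0,T)} ‖u t‖_{L³} ≤ C < ⊤` (`iSup₂_le`, `ENNReal.coe_lt_top`); `L3Closure` continues `u`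
past `T`; `NoBlowupToClay` (item stmt-NavierStokesRegularity-0055) yields Clay (A).

HONEST FRAMING: glue between the route's own statements (about HYPOTHETICAL objects); nothing
here bears on the regularity problem itself.
-/

noncomputable section

set_option linter.dupNamespace false

namespace Summit.NavierStokesRegularity.NavierStokesRegularity.Theorems

/-- **Item stmt-NavierStokesRegularity-1448** (`QuasipotentialCoercivity.Assembly`): action
coercivity in `L³` along reachable slices bounds `sup_t ‖u t‖_{L³}`, the `L³` closure continues the
solution, and the no-blow-up ⇒ Clay glue concludes. [this file] -/
theorem quasipotentialCoercivity_assembly_proof :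
    Summit.NavierStokesRegularity.NavierStokesRegularity.Theses.QuasipotentialCoercivity.Assembly := by
  unfold Summit.NavierStokesRegularity.NavierStokesRegularity.Theses.QuasipotentialCoercivity.Assembly
  intro hA hR hL hN
  refine hN fun ν T hν hT u p hcl hLH hdec => ?_
  obtain ⟨τ, a, hτ, hreach⟩ := hR ν T hν hT u p hcl hLH hdec
  obtain ⟨C, hC⟩ := hA ν hν τ hτ a
  have hle : (⨆ t ∈ Set.Ico 0 T, MeasureTheory.eLpNorm (u t) 3 MeasureTheory.volume) ≤ (C : ENNReal) :=
    iSup₂_le fun t ht => hC (u t) (hreach t ht)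
  exact hL ν T hν hT u p hcl hLH hdec (lt_of_le_of_lt hle ENNReal.coe_lt_top)

end Summit.NavierStokesRegularity.NavierStokesRegularity.Theorems

end
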